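import Summits.HodgeConjecture.HodgeConjecture.Theorems.Ring2WeilCoverageCMFieldRationalClassesPrimeSupportCyclic
import Summits.HodgeConjecture.HodgeConjecture.Theorems.Ring2WeilCoverageCMFieldRationalClassesCyclicFibres
import Summits.HodgeConjecture.HodgeConjecture.Theorems.Ring2WeilCoverageCMFieldCyclicPrimeRuleSqrtTwo
import HarnessLib

/-!
# Ring 2 — Weil-family coverage, CM-field rows: the union statement for the cyclic table `E = ℚ(√-(2+√2))`
  (conductor `16`, `F = ℚ(√2)`) (WEIL-FAMILY-COVERAGE «## b03», cell (xxi⁸), part 51)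

research route conditional on HC_CM; not a corollary; Q11.4-sentence-2 already refuted in dim ≥ 3.

Carrier `R = S² + 4S + 2` (`θ = η² = -(2+√2)`, `q = 2 = (θ+2)²`, `p² - 4q = 8`; rows `δ ∈ F^×/Nm_{E/F}(E^×)` labelled by
`T(t) = {𝔭 : (t, θ)_𝔭 = -1}`) [cite: Deligne1982HodgeCycles, §4 p. 30, (1), Cor. 4.2].  `F = ℚ(√2)` has ONE place ramified
over `ℚ`, the DYADIC place `v₂ = (√2) = (θ)`, and the prime rule of part 26 reads `[ℓ] = [1] ⟺ ℓ = 2 ∨ ℓ mod 16 ∈ {1, 7}`.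
This file discharges the hypotheses of parts 46–47 for this carrier:

* §147 places over `2` unique, `T(2) = ∅`; every ODD place lying in `T(ℓ)` contains `ℓ` (`θ ∉ v`; 63:12); **`v₂ ∈ T(ℓ) ⟺
  ℓ ≡ ±3 (mod 8)`** — by fibre parity (part 47 (b)/(c)): for `ℓ` inert in `F` the unique place `(ℓ)` is bad, for `ℓ` split
  the bad places over `ℓ` come in pairs.
* §148 **THE UNION STATEMENT**: for `c ∈ ℚ_{>0}` and an odd place `v` over `ℓ`:
  **`v ∈ T(c) ⟺ ord_ℓ(c)` odd `∧ ¬(ℓ = 2 ∨ ℓ mod 16 ∈ {1, 7})`**; at the dyadic place: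
  **`v₂ ∈ T(c) ⟺` the number of prime factors `ℓ ≡ ±3 (mod 8)` of `num(c)·den(c)`, with multiplicity, is odd**;
  **`[c] = [c'] ⟺` equal exponent parities at every non-norm prime**; **`[c] = [1] ⟺` all even**.

No new definition, no named fact, no sorry; nothing about the Hodge conjecture is asserted.
-/

noncomputable section

set_option linter.dupNamespace false

open Polynomial NumberField IsDedekindDomain

namespace Summit.HodgeConjecture.HodgeConjecture.Ring2.WeilCoverageCM

open Literature.AlgebraicGeometry.Deligne1982
open Literature.AlgebraicGeometry.HodgeTheory (splitDiscriminantClassCM)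
open Literature.NumberTheory.QuadraticForms

variable {R : Polynomial ℤ} [Fact (Irreducible (cmPolyQ R))] [Fact (Irreducible (realPolyQ R))]

/-! ### §147 `ℚ(√-(2+√2))`: the places of `F = ℚ(√2)` against `T(ℓ)` -/

section Cond16

omit [Fact (Irreducible (cmPolyQ R))] in
/-- `ℚ(√-(2+√2))`: **the places of `F` over the primes dividing `2q = 4` are unique** (the dyadic place `(√2)`). [folklore] -/
theorem sqrtNegTwoPlusSqrtTwo_places_unique_of_dvd (hR : R = X ^ 2 + C 4 * X + C 2) {ℓ : ℕ} (hℓ : ℓ.Prime)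
    (hdvd : (ℓ : ℤ) ∣ 2 * 2) (v v' : HeightOneSpectrum (𝓞 (realField R))) (hv : (ℓ : 𝓞 (realField R)) ∈ v.asIdeal)
    (hv' : (ℓ : 𝓞 (realField R)) ∈ v'.asIdeal) : v = v' := by
  have h235 : ℓ ∣ 2 ^ 2 * 3 ^ 0 * 5 ^ 0 := by norm_num; exact_mod_cast hdvd
  rcases eq_of_prime_dvd_two_pow_mul hℓ h235 with rfl | rfl | rfl
  · exact sqrtNegTwoPlusSqrtTwo_ratPrimeRule_dyadic_unique hR v v' (by exact_mod_cast hv) (by exact_mod_cast hv')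
  · omega
  · omega

/-- `ℚ(√-(2+√2))`: `T(2) = ∅` (`2 = (θ+2)²`). [cite: Deligne1982HodgeCycles, §4 Cor. 4.2] -/
theorem sqrtNegTwoPlusSqrtTwo_badPlaces_two (hR : R = X ^ 2 + C 4 * X + C 2) :
    badPlaces ((2 : ℕ) : realField R) (AdjoinRoot.root (realPolyQ R)) = ∅ := by
  have h0 : ((2 : ℕ) : realField R) ≠ 0 := by norm_num
  have h := (mk_eq_splitDiscriminantClassCM_iff_badPlaces_eq_empty (R := R) (Units.mk0 ((2 : ℕ) : realField R) h0) even_two).1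
    (sqrtNegTwoPlusSqrtTwo_ratPrimeRule_mk_two_eq_splitDiscriminantClassCM hR _ (by rw [Units.val_mk0, Nat.cast_ofNat]) even_two)
  rwa [Units.val_mk0] at h

/-- `ℚ(√-(2+√2))`: **an odd place lying in `T(ℓ)` contains `ℓ`** (`θ ∉ v` since `θ ∈ v` forces `2 ∈ v`; O'Meara 63:12) — the
hypothesis `hfix` of part 46 with `p₀ = 2`. [cite: Omeara1963, §63B Example 63:12] -/
theorem sqrtNegTwoPlusSqrtTwo_natCast_mem_of_inl_mem_badPlaces (hR : R = X ^ 2 + C 4 * X + C 2)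
    (v : HeightOneSpectrum (𝓞 (realField R))) (h2 : (2 : 𝓞 (realField R)) ∉ v.asIdeal) (ℓ : ℕ) (hℓ : ℓ.Prime)
    (hv : Sum.inl v ∈ badPlaces (ℓ : realField R) (AdjoinRoot.root (realPolyQ R))) : (ℓ : 𝓞 (realField R)) ∈ v.asIdeal := by
  obtain ⟨hRm, -⟩ := monic_and_natDegree_of_quadratic R hR
  obtain ⟨θₒ, hθ⟩ := exists_ringOfIntegers_coe_eq_root hRm
  have hθv : θₒ ∉ v.asIdeal := fun h ↦ by
    have hq : ((2 : ℤ) : 𝓞 (realField R)) ∈ v.asIdeal := intCast_mem_of_root_mem hR hθ v h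
    exact h2 (by exact_mod_cast hq)
  have hfac : AdjoinRoot.root (realPolyQ R) = (1 : realField R) ^ 2 * (θₒ : realField R) := by rw [one_pow, one_mul, hθ]
  exact natCast_mem_of_inl_mem_badPlaces hfac v h2 hθv hℓ hv

/-- **`ℚ(√-(2+√2))`: THE DYADIC (RAMIFIED) PLACE `v₂ = (√2)` lies in `T(ℓ)` iff `ℓ ≡ ±3 (mod 8)`** — fibre parity: for `ℓ` inert in
`F = ℚ(√2)` (`2` a non-square mod `ℓ`) the unique place `(ℓ)` is bad and `T(ℓ) ∖ {v₂} = {(ℓ)}`; for `ℓ` split the bad places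
over `ℓ` come in pairs; `T(2) = ∅`. [cite: Omeara1963, §71D Thm. 71:18 and §63B Example 63:12] [cite: Deligne1982HodgeCycles, §4 (1)] -/
theorem sqrtNegTwoPlusSqrtTwo_inl_mem_badPlaces_natCast_iff_of_mem_two (hR : R = X ^ 2 + C 4 * X + C 2)
    (v₂ : HeightOneSpectrum (𝓞 (realField R))) (h2 : (2 : 𝓞 (realField R)) ∈ v₂.asIdeal) {ℓ : ℕ} (hℓ : ℓ.Prime) :
    Sum.inl v₂ ∈ badPlaces (ℓ : realField R) (AdjoinRoot.root (realPolyQ R)) ↔ ℓ % 8 = 3 ∨ ℓ % 8 = 5 := by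
  by_cases hℓ2 : ℓ = 2
  · subst hℓ2
    rw [sqrtNegTwoPlusSqrtTwo_badPlaces_two hR]
    exact iff_of_false (Set.notMem_empty _) (by norm_num)
  haveI := Fact.mk hℓ
  have hK := finrank_realField_quadratic hR
  have hroots := roots_real_neg_of_quadratic hR (by norm_num) (by norm_num) (by norm_num)
  obtain ⟨hRm, -⟩ := monic_and_natDegree_of_quadratic R hR
  obtain ⟨θₒ, hθ⟩ := exists_ringOfIntegers_coe_eq_root hRm
  have hrel := ringOfIntegers_root_rel_quadratic hR hθ
  push_cast at hrel
  have hs₀ : (θₒ + 2) ^ 2 = ((2 : ℤ) : 𝓞 (realField R)) := by push_cast; linear_combination hrel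
  have huniq2 : ∀ u : HeightOneSpectrum (𝓞 (realField R)), (2 : 𝓞 (realField R)) ∈ u.asIdeal → u = v₂ := fun u hu ↦
    sqrtNegTwoPlusSqrtTwo_ratPrimeRule_dyadic_unique hR u v₂ hu h2
  have H1 := fun u h2u hu ↦ sqrtNegTwoPlusSqrtTwo_natCast_mem_of_inl_mem_badPlaces hR u h2u ℓ hℓ hu
  have h20 : (2 : ZMod ℓ) ≠ 0 := by exact_mod_cast natCast_prime_ne_zero_zmod Nat.prime_two hℓ2
  have hℓq : ¬ (ℓ : ℤ) ∣ 2 := fun h ↦ hℓ2 ((Nat.prime_dvd_prime_iff_eq hℓ Nat.prime_two).1 (by exact_mod_cast h))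
  have hℓdisc : ¬ (ℓ : ℤ) ∣ (4 : ℤ) ^ 2 - 4 * 2 := fun h ↦ by
    have h' : ℓ ∣ 2 ^ 3 * 3 ^ 0 * 5 ^ 0 := by norm_num at h ⊢; exact_mod_cast h
    rcases eq_of_prime_dvd_two_pow_mul hℓ h' with rfl | rfl | rfl <;> omega
  have e8 : (((4 : ℤ) ^ 2 - 4 * 2 : ℤ) : ZMod ℓ) = 2 * 2 ^ 2 := by push_cast; norm_num
  by_cases hin : ℓ % 8 = 3 ∨ ℓ % 8 = 5
  · refine iff_of_true ?_ hin
    have hn2 : ¬ IsSquare (2 : ZMod ℓ) := by rw [ZMod.exists_sq_eq_two_iff hℓ2]; omega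
    have hdisc : ¬ IsSquare (((4 : ℤ) ^ 2 - 4 * 2 : ℤ) : ZMod ℓ) := by
      rw [e8, isSquare_mul_sq_iff_of_ne_zero h20]; exact hn2
    have hq : ¬ IsSquare (((2 : ℤ) : ℤ) : ZMod ℓ) := by
      have e : (((2 : ℤ) : ℤ) : ZMod ℓ) = 2 := by push_cast; norm_num
      rw [e]; exact hn2
    obtain ⟨u₀, hℓu₀⟩ := exists_place_natCast_mem hK hℓ
    refine inl_mem_badPlaces_natCast_of_diff_singleton hroots v₂ h2 huniq2 hℓ hℓ2 H1 u₀ hℓu₀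
      (inl_mem_badPlaces_natCast_of_not_isSquare_disc_const hR hθ hℓ hℓ2 hdisc hq u₀ hℓu₀) fun u u' hu hu' ↦ ?_
    exact (eq_of_natCast_mem_of_absNorm_eq_sq hK hℓ u u' hu hu' (absNorm_eq_sq_of_not_isSquare_disc hR hθ hℓ hdisc u hu)).symm
  · refine iff_of_false ?_ hin
    have hodd : ℓ % 2 = 1 := (Nat.Prime.mod_two_eq_one_iff_ne_two hℓ).2 hℓ2
    have hsp : ℓ % 8 = 1 ∨ ℓ % 8 = 7 := by omega
    have hdsq : IsSquare (((4 : ℤ) ^ 2 - 4 * 2 : ℤ) : ZMod ℓ) := by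
      rw [e8, isSquare_mul_sq_iff_of_ne_zero h20, ZMod.exists_sq_eq_two_iff hℓ2]; exact hsp
    exact inl_notMem_badPlaces_natCast_of_diff_pair hroots v₂ h2 huniq2 hℓ hℓ2 H1
      fun w hℓw hw ↦ exists_partner_of_isSquare_disc hR hθ hs₀ hℓ hℓ2 hℓq hℓdisc hdsq w hℓw hw

/-! ### §148 `ℚ(√-(2+√2))`: the union statement and the classes of the positive rationals -/

/-- **`ℚ(√-(2+√2))` — THE UNION STATEMENT away from the dyadic place**: for `c ∈ ℚ_{>0}` and an ODD place `v` of
`F = ℚ(√2)` over the prime `ℓ`: **`v ∈ T(c) ⟺ ord_ℓ(c)` is odd `∧ ¬(ℓ = 2 ∨ ℓ mod 16 ∈ {1, 7})`**.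
[cite: Deligne1982HodgeCycles, §4 (1) and Cor. 4.2] [cite: Omeara1963, §63B Example 63:12 and §71D Thm. 71:18] -/
theorem sqrtNegTwoPlusSqrtTwo_inl_mem_badPlaces_ratCast_iff_odd_padicValRat (hR : R = X ^ 2 + C 4 * X + C 2)
    {c : ℚ} (hc : 0 < c) (v : HeightOneSpectrum (𝓞 (realField R))) (h2 : (2 : 𝓞 (realField R)) ∉ v.asIdeal)
    {ℓ : ℕ} (hℓ : ℓ.Prime) (hℓv : (ℓ : 𝓞 (realField R)) ∈ v.asIdeal) :
    Sum.inl v ∈ badPlaces (c : realField R) (AdjoinRoot.root (realPolyQ R)) ↔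
      Odd (padicValRat ℓ c) ∧ ¬ (ℓ = 2 ∨ ℓ % 16 = 1 ∨ ℓ % 16 = 7) := by
  have hroots := roots_real_neg_of_quadratic hR (by norm_num) (by norm_num) (by norm_num)
  obtain ⟨hRm, -⟩ := monic_and_natDegree_of_quadratic R hR
  obtain ⟨θₒ, hθ⟩ := exists_ringOfIntegers_coe_eq_root hRm
  have hrel := ringOfIntegers_root_rel_quadratic hR hθ
  push_cast at hrel
  have hs₀ : (θₒ + 2) ^ 2 = ((2 : ℤ) : 𝓞 (realField R)) := by push_cast; linear_combination hrel
  have hℓ0 : (ℓ : realField R) ≠ 0 := by exact_mod_cast hℓ.ne_zero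
  have hT := badPlaces_nonempty_iff_mk_ne_splitDiscriminantClassCM (R := R) (Units.mk0 (ℓ : realField R) hℓ0) even_two
  rw [Units.val_mk0, Ne, sqrtNegTwoPlusSqrtTwo_ratPrimeRule_mk_prime_eq_splitDiscriminantClassCM_iff_mod hR hℓ _
    (Units.val_mk0 _) even_two] at hT
  rw [inl_mem_badPlaces_ratCast_iff_odd_padicValRat_of_ramified hR hroots hθ hs₀ Nat.prime_two (by norm_num)
    (fun ℓ' hℓ' hd ↦ sqrtNegTwoPlusSqrtTwo_places_unique_of_dvd hR hℓ' hd)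
    (fun u hu ↦ sqrtNegTwoPlusSqrtTwo_natCast_mem_of_inl_mem_badPlaces hR u (by exact_mod_cast hu)) hc v
    (by exact_mod_cast h2) hℓ hℓv, hT]

/-- **`ℚ(√-(2+√2))` — THE DYADIC PLACE**: for `c ∈ ℚ_{>0}`, **`v₂ ∈ T(c)` iff the number of prime factors `ℓ ≡ ±3 (mod 8)` of
`num(c)·den(c)`, counted with multiplicity, is odd**. [cite: Deligne1982HodgeCycles, §4 (1)] [cite: Omeara1963, §71D Thm. 71:18] -/
theorem sqrtNegTwoPlusSqrtTwo_inl_mem_badPlaces_ratCast_iff_of_mem_two (hR : R = X ^ 2 + C 4 * X + C 2)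
    {c : ℚ} (hc : 0 < c) (v : HeightOneSpectrum (𝓞 (realField R))) (h2 : (2 : 𝓞 (realField R)) ∈ v.asIdeal) :
    Sum.inl v ∈ badPlaces (c : realField R) (AdjoinRoot.root (realPolyQ R)) ↔
      Odd ((c.num.natAbs * c.den).factorization.sum fun ℓ e ↦ if ℓ % 8 = 3 ∨ ℓ % 8 = 5 then e else 0) :=
  mem_badPlaces_ratCast_iff_odd_sum_factorization _ (fun ℓ ↦ ℓ % 8 = 3 ∨ ℓ % 8 = 5)
    (fun _ hℓ ↦ sqrtNegTwoPlusSqrtTwo_inl_mem_badPlaces_natCast_iff_of_mem_two hR v h2 hℓ) hc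

/-- **`ℚ(√-(2+√2))` — THE CLASSES OF THE POSITIVE RATIONALS**: for `c, c' ∈ ℚ_{>0}`, **`[c] = [c']` in `F^×/Nm_{E/F}(E^×)` iff
`ord_ℓ(c) ≡ ord_ℓ(c') (mod 2)` for every odd prime `ℓ` with `ℓ mod 16 ∉ {1, 7}`**. [cite: Deligne1982HodgeCycles, §4 (1),
Prop. 4.1 and Cor. 4.2] [cite: Omeara1963, §65D Thm. 65:23 and §71D Thm. 71:18] -/
theorem sqrtNegTwoPlusSqrtTwo_mk_ratCast_eq_mk_ratCast_iff (hR : R = X ^ 2 + C 4 * X + C 2) {c c' : ℚ}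
    (hc : 0 < c) (hc' : 0 < c') (γ γ' : (realField R)ˣ) (hγ : (γ : realField R) = (c : realField R))
    (hγ' : (γ' : realField R) = (c' : realField R)) :
    (QuotientGroup.mk γ : cmNormResidueGroup R) = QuotientGroup.mk γ' ↔
      ∀ ℓ : ℕ, ℓ.Prime → ¬ (ℓ = 2 ∨ ℓ % 16 = 1 ∨ ℓ % 16 = 7) → (Odd (padicValRat ℓ c) ↔ Odd (padicValRat ℓ c')) := by
  have hroots := roots_real_neg_of_quadratic hR (by norm_num) (by norm_num) (by norm_num)
  obtain ⟨hRm, -⟩ := monic_and_natDegree_of_quadratic R hR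
  obtain ⟨θₒ, hθ⟩ := exists_ringOfIntegers_coe_eq_root hRm
  have hrel := ringOfIntegers_root_rel_quadratic hR hθ
  push_cast at hrel
  have hs₀ : (θₒ + 2) ^ 2 = ((2 : ℤ) : 𝓞 (realField R)) := by push_cast; linear_combination hrel
  rw [mk_ratCast_eq_mk_ratCast_iff_of_ramified hR hroots hθ hs₀ Nat.prime_two (by norm_num)
    (fun ℓ' hℓ' hd ↦ sqrtNegTwoPlusSqrtTwo_places_unique_of_dvd hR hℓ' hd)
    (fun u hu ↦ sqrtNegTwoPlusSqrtTwo_natCast_mem_of_inl_mem_badPlaces hR u (by exact_mod_cast hu))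
    (sqrtNegTwoPlusSqrtTwo_badPlaces_two hR) hc hc' γ γ' hγ hγ']
  refine forall_congr' fun ℓ ↦ forall_congr' fun hℓ ↦ ?_
  have hℓ0 : (ℓ : realField R) ≠ 0 := by exact_mod_cast hℓ.ne_zero
  have hT := badPlaces_nonempty_iff_mk_ne_splitDiscriminantClassCM (R := R) (Units.mk0 (ℓ : realField R) hℓ0) even_two
  rw [Units.val_mk0, Ne, sqrtNegTwoPlusSqrtTwo_ratPrimeRule_mk_prime_eq_splitDiscriminantClassCM_iff_mod hR hℓ _
    (Units.val_mk0 _) even_two] at hT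
  rw [hT]

/-- **`ℚ(√-(2+√2))` — THE SPLIT ROW**: for `c ∈ ℚ_{>0}`, **`[c] = [(-1)^k]` (`k` even) iff `ord_ℓ(c)` is even for every odd prime
`ℓ` with `ℓ mod 16 ∉ {1, 7}`.** [cite: Deligne1982HodgeCycles, §4 Cor. 4.2] [cite: Omeara1963, §65D Thm. 65:23] -/
theorem sqrtNegTwoPlusSqrtTwo_mk_ratCast_eq_splitDiscriminantClassCM_iff (hR : R = X ^ 2 + C 4 * X + C 2) {c : ℚ}
    (hc : 0 < c) (γ : (realField R)ˣ) (hγ : (γ : realField R) = (c : realField R)) {k : ℕ} (hk : Even k) :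
    (QuotientGroup.mk γ : cmNormResidueGroup R) = splitDiscriminantClassCM R k ↔
      ∀ ℓ : ℕ, ℓ.Prime → ¬ (ℓ = 2 ∨ ℓ % 16 = 1 ∨ ℓ % 16 = 7) → Even (padicValRat ℓ c) := by
  have hroots := roots_real_neg_of_quadratic hR (by norm_num) (by norm_num) (by norm_num)
  obtain ⟨hRm, -⟩ := monic_and_natDegree_of_quadratic R hR
  obtain ⟨θₒ, hθ⟩ := exists_ringOfIntegers_coe_eq_root hRm
  have hrel := ringOfIntegers_root_rel_quadratic hR hθ
  push_cast at hrel
  have hs₀ : (θₒ + 2) ^ 2 = ((2 : ℤ) : 𝓞 (realField R)) := by push_cast; linear_combination hrel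
  rw [mk_ratCast_eq_splitDiscriminantClassCM_iff_of_ramified hR hroots hθ hs₀ Nat.prime_two (by norm_num)
    (fun ℓ' hℓ' hd ↦ sqrtNegTwoPlusSqrtTwo_places_unique_of_dvd hR hℓ' hd)
    (fun u hu ↦ sqrtNegTwoPlusSqrtTwo_natCast_mem_of_inl_mem_badPlaces hR u (by exact_mod_cast hu))
    (sqrtNegTwoPlusSqrtTwo_badPlaces_two hR) hc γ hγ hk]
  refine forall_congr' fun ℓ ↦ forall_congr' fun hℓ ↦ ?_
  have hℓ0 : (ℓ : realField R) ≠ 0 := by exact_mod_cast hℓ.ne_zero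
  have hT := badPlaces_nonempty_iff_mk_ne_splitDiscriminantClassCM (R := R) (Units.mk0 (ℓ : realField R) hℓ0) even_two
  rw [Units.val_mk0, Ne, sqrtNegTwoPlusSqrtTwo_ratPrimeRule_mk_prime_eq_splitDiscriminantClassCM_iff_mod hR hℓ _
    (Units.val_mk0 _) even_two] at hT
  rw [hT]

end Cond16

end Summit.HodgeConjecture.HodgeConjecture.Ring2.WeilCoverageCM

end
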